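import Summits.ABC.IUTFork.Cor312LicenceTameExactGenuineK
import Summits.ABC.IUTFork.Repair.CandInternal2RealLabels
import HarnessLib

/-!
# IUT REPAIR branch → R-H (D-0079 «local-height I06⋆»): the REAL I06⋆ cell JOINED to the (xi-f) licence cell on the TAME stratum —
# «q̲_w ∈ q̲_w^{j²}·ℐ_{K_w} ⟹ q-region ⊆ ⁿ˚𝒰 at (j, p) ⟹ q̲_w ∈ q̲_w^{j}·ℐ_{K_w}», and the licence cell EXACTLY in I06⋆ currency (v2)

PROOF-ONLY k2-engine file (D-0012: 0 definitions, 0 `Prop` facts, no instance, no notation) of the abc-iut cell, rung LADDER-ABC:A2.RESCUE.H;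
seat abc-iut-w5-d068 gen 6 (plan/rescue/R-H/START-HERE.md v1.1 §6: GO «RH-TAME-JOIN» (A)(B)(C), rh-lead 14:59:41Z). TAKES NO SIDE on
[IUTchIII] Cor. 3.12 or on any author; RP-I06⋆ is abc-iut-rp-d2's CANDIDATE READING (a bound hypothesis, never asserted); typed ≠ proved;
instantiated ≠ endorsed; refuted-as-typed ≠ refuted-in-print. INPUTS, BY NAME (nothing re-typed): the REAL I06⋆ cell `q̲_w ∈ q̲_w^{j²}·ℐ_{K_w}`,
`ℐ_{K_w} = (p*)⁻¹·log_p(𝒪^×_{K_w})` (abc-iut-rp-d2 `CandInternal2RealLabels` p450037, tame closed form `mem_pow_smul_logShell_iff_of_le`); branch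
C's LICENCE CELL «q-pilot region at `(j, p)` ⊆ `ⁿ˚𝒰_{j,p}`» at `settingDHVolSharp` / `settingPrVolSharp`, decided on uniformly tame fibres by
abc-iut-w4-d006 / w5-d180 `qRegion_subset_thetaHull_settingDHVolSharp_iff_of_tame_orders` (p445158; licence level p445547); abc-iut-w5-d009's
legs `tame_exact_iff_emod` / `tame_exact_of_sufficient_leg` / `necessary_leg_of_tame_exact`. The single-place slack form of (A) over a UNIQUE
tame place is abc-iut-rp-h3's `CandInternal11GapGenuineTame` (p450461); here rp-d2's membership predicate itself is the hypothesis and several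
uniformly tame places over `p` are allowed. CONTENT: §1 `mem_pow_smul_logShell_iff_int_of_tame(_unif)` (**`q ∈ qⁿ·ℐ_K ⟺ (n−1)·m ≤ e−1`**),
`int_sandwich_strict` ((C)); §2 (A) `qRegion_subset_thetaHull_settingDHVolSharp_of_realStar_tame` (I06⋆ cells ⟹ licence cell),
`realLinear_of_qRegion_subset_thetaHull_settingDHVolSharp_tame` (licence cell ⟹ LINEAR shell cells), (B, v2)
`qRegion_subset_thetaHull_settingDHVolSharp_iff_emod_tame`; §3 `licence_settingPrVolSharp_of_realStar_tame`,
`exists_qPinned_and_hull_settingPrVolSharp_of_realStar_tame` (branch C's S_H antecedent), `realLinear_of_licence_settingPrVolSharp_tame`; part 2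
= `CandInternal2RealLabelsLicenceGenuineK` (genuine datum `Cor312Prov.pilotDataOfK`, realising ideles).
READING (START-HERE v1.1 §3 (L1); neutral): on the TAME stratum QUADRATIC shell `(j²−1)·m_q ≤ e−1` (= I06⋆ cell) ⟹ LICENCE cell
`(j²−1)·m_q ≤ j·(e−1) + ((j²m_q−1) mod e)` ⟹ LINEAR shell `(j−1)·m_q ≤ e−1`, both strictly — the band `θ_j ∈ [1, j]`; wild / boundary cells
are not decided here. HONEST SCOPE (binding): OUR sharp containers (Θ-regions constant in `m`), Dupuy–Hilado's typed (Ind1)/(Ind2) per (capsule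
slot, place); the packet-level / hull-level licence is a STRONGER-THAN-PRINT form of Step (xi-f); nothing about the printed GLOBAL inequality;
nothing asserts or refutes [IUTchIII] Cor. 3.12. [cite: Mochizuki2012, IUTchIII Cor. 3.12 p. 173–174, Step (xi-f) p. 184; IUTchIV Prop. 1.2 (i)(ii) p. 10]
[cite: MochizukiAbsTopIII2015, Def 5.4 (iii) p. 126] [cite: DupuyHilado2025, §3.4, §3.9, §4.9] [cite: ScholzeStix2018, §2.2 pp. 9–10] [claim: Mochizuki2012, status: disputed]. Axioms: standard.
-/

noncomputable section

open Set Metric Function NumberField IsDedekindDomain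
open scoped Pointwise

namespace Summit.ABC.IUTFork.Repair.CandInternal2RealLabelsLicence

open Literature.AnabelianGeometry.AbsoluteAnabelian Literature.IUT.LogThetaLattice Literature.IUT.LogVolume
  Literature.NumberTheory.NumberFields Literature.NumberTheory.GaloisRepresentations.Ultrametric
open Summit.ABC.IUTFork.Thm311 Summit.ABC.IUTFork.Thm311.Real Summit.ABC.IUTFork.Cor312 Summit.ABC.IUTFork.Cor312.Setting
  Summit.ABC.IUTFork.Cor312Vol Summit.ABC.IUTFork.Repair.CandInternal2RealLabels

/-! ## §1. One place: rp-d2's tame window in INTEGER currency -/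

section OnePlace

variable (p : ℕ) [Fact p.Prime]
variable (K : Type*) [NontriviallyNormedField K] [NormedAlgebra ℚ_[p] K] [IsUltrametricDist K] [ProperSpace K]

/-- **rp-d2's tame window with the ramification index cleared.** For `p > 2`, `e = e_K ≤ p − 2`, `q ≠ 0` with `‖q‖ = p^{−m/e}` (`m ∈ ℤ`,
i.e. `ord_K(q) = m`): `q ∈ qⁿ · ℐ_K ⟺ (n − 1)·m ≤ e − 1` (`CandInternal2RealLabels.mem_pow_smul_logShell_iff_of_le` × `e`).
[cite: MochizukiAbsTopIII2015, Def 5.4 (iii) p. 126] [cite: Mochizuki2012, IUTchIV Prop. 1.2 (i) p. 10] [claim: Mochizuki2012, status: disputed] -/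
theorem mem_pow_smul_logShell_iff_int_of_tame (hp : 2 < p) (he : absRamificationIdx p K ≤ p - 2) {q : K} (hq : q ≠ 0)
    {m : ℤ} (hqh : ‖q‖ = (p : ℝ) ^ (-((m : ℝ) / (absRamificationIdx p K : ℝ)))) (n : ℕ) :
    q ∈ q ^ n • logShell (PadicLogOnUnits.ofUnitLog p K) ↔ ((n : ℤ) - 1) * m ≤ (absRamificationIdx p K : ℤ) - 1 := by
  rw [mem_pow_smul_logShell_iff_of_le p K hp he hq hqh n]
  have he0 : (0 : ℝ) < (absRamificationIdx p K : ℝ) := by exact_mod_cast absRamificationIdx_pos p K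
  have h1 : ((n : ℝ) - 1) * ((m : ℝ) / (absRamificationIdx p K : ℝ)) = (((n : ℝ) - 1) * m) / (absRamificationIdx p K : ℝ) := by
    ring
  have h2 : (1 : ℝ) - 1 / (absRamificationIdx p K : ℝ) = ((absRamificationIdx p K : ℝ) - 1) / (absRamificationIdx p K : ℝ) := by
    field_simp
  rw [h1, h2, div_le_div_iff_of_pos_right he0]
  constructor
  · intro h
    have h' : (((n : ℤ) - 1) * m : ℝ) ≤ ((absRamificationIdx p K : ℤ) - 1 : ℝ) := by push_cast; exact h
    exact_mod_cast h'
  · intro h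
    have h' : (((n : ℤ) - 1) * m : ℝ) ≤ ((absRamificationIdx p K : ℤ) - 1 : ℝ) := by exact_mod_cast h
    push_cast at h'
    exact h'

/-- **The same with a norm uniformizer** (`‖q‖ = ‖ϖ‖^m`, `‖ϖ‖ = p^{−1/e}`): `q ∈ qⁿ · ℐ_K ⟺ (n − 1)·m ≤ e − 1`.
[cite: MochizukiAbsTopIII2015, Def 5.4 (iii) p. 126] [claim: Mochizuki2012, status: disputed] -/
theorem mem_pow_smul_logShell_iff_int_of_tame_unif (hp : 2 < p) (he : absRamificationIdx p K ≤ p - 2) {ϖ : Kˣ}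
    (hϖ : IsUniformizer ϖ) {q : K} (hq : q ≠ 0) {m : ℤ} (hqm : ‖q‖ = ‖(ϖ : K)‖ ^ m) (n : ℕ) :
    q ∈ q ^ n • logShell (PadicLogOnUnits.ofUnitLog p K) ↔ ((n : ℤ) - 1) * m ≤ (absRamificationIdx p K : ℤ) - 1 := by
  apply mem_pow_smul_logShell_iff_int_of_tame p K hp he hq _ n
  have hp0 : (0 : ℝ) < p := by exact_mod_cast (Fact.out : p.Prime).pos
  rw [hqm, norm_eq_rpow_of_isUniformizer p K hϖ, ← Real.rpow_intCast, ← Real.rpow_mul hp0.le]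
  congr 1
  ring

/-- **Integer strictness witnesses for the sandwich «quadratic ⟹ licence ⟹ linear».** At `(e, m, j) = (3, 1, 2)` the exact tame licence
predicate `e·((j²m − 1) div e) + 1 − j(e−1) ≤ m` HOLDS while the quadratic shell condition `(j²−1)·m ≤ e−1` FAILS; at `(e, m, j) = (5, 4, 2)` the
linear shell condition `(j−1)·m ≤ e−1` HOLDS while the licence predicate FAILS. [folklore] -/
theorem int_sandwich_strict :
    ((3 : ℤ) * (((2 : ℤ) ^ 2 * 1 - 1) / 3) + 1 - 2 * (3 - 1) ≤ 1 ∧ ¬ (((2 : ℤ) ^ 2 - 1) * 1 ≤ 3 - 1)) ∧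
      (((2 : ℤ) - 1) * 4 ≤ 5 - 1 ∧ ¬ ((5 : ℤ) * (((2 : ℤ) ^ 2 * 4 - 1) / 5) + 1 - 2 * (5 - 1) ≤ 4)) := by
  refine ⟨⟨by norm_num, by norm_num⟩, by norm_num, by norm_num⟩

end OnePlace

/-! ## §2. The sharp real setting, one uniformly tame packet -/

section Setting

variable {F : Type} [Field F] [NumberField F] (X : PilotData F) {logv : PadicLogs F} (hlog : LogvAnalytic logv)
  (M : Type) [Field M] [NumberField M]
  (archPk : ∀ (j : (thetaIndex X).Label) (vQ : (thetaIndex X).VQ), Set ((logShellsDH X logv).Packet j vQ))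
  (archSub : ∀ (j : (thetaIndex X).Label) (v : (thetaIndex X).V),
    Set ((logShellsDH X logv).Packet j ((thetaIndex X).over v)))
  (Ψ : ℤ → ∀ v : (thetaIndex X).V, v ∈ (thetaIndex X).Vbad → Set ((logShellsDH X logv).StarPacket v))
  (act : ℤ → ∀ v : (thetaIndex X).V, v ∈ (thetaIndex X).Vbad →
    (logShellsDH X logv).StarPacket v → Module.End ℚ ((logShellsDH X logv).StarPacket v))
  (Mmod : ℤ → ∀ j : (thetaIndex X).LabelStar, Set ((logShellsDH X logv).GlobalPacket j.1))
  (region : ℤ → ∀ j : (thetaIndex X).LabelStar, FinDivisor M → ∀ vQ : (thetaIndex X).VQ,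
    Set ((logShellsDH X logv).Packet j.1 vQ))
  (n : ℤ) {HT : Type} {LogLink : HT → HT → Type} {IsFull : ∀ {s t : HT}, LogLink s t → Prop}
  (lat : LGPGaussianLogThetaLattice LogLink IsFull)
  {Frd : Type} {IsoF : Frd → Frd → Type} {Ob : Frd → Type} {realify : Frd → Frd} {Strip : Type}
  {IsoS : Strip → Strip → Type} {Mv : ∀ v : (thetaIndex X).V, v ∈ (thetaIndex X).Vbad → Type}
  [∀ v h, Monoid (Mv v h)]
  (sig : GlobalLGPFrobenioidSignature (thetaIndex X).lstar (thetaIndex X).V (· ∈ (thetaIndex X).Vbad)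
    Frd IsoF Ob realify Strip IsoS Mv)
  (split : SplittingMonoids Mv) {ObΔ : Type} {N : ∀ v : (thetaIndex X).V, v ∈ (thetaIndex X).Vbad → Type}
  [∀ v h, Monoid (N v h)] (qData : QPilotData ObΔ N)
  (tq : ∀ (pp : Nat.Primes) (x : (thetaIndex X).Fibre (.inr pp)), haveI : Fact (pp : ℕ).Prime := ⟨pp.2⟩; kOf X pp.1 x)
  (t : ∀ (pp : Nat.Primes) (_ : Fin X.lstar) (x : (thetaIndex X).Fibre (.inr pp)),
    haveI : Fact (pp : ℕ).Prime := ⟨pp.2⟩; kOf X pp.1 x)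
  (htq0 : ∀ pp x, tq pp x ≠ 0)
  (htq1 : ∀ (pp : Nat.Primes) (x : (thetaIndex X).Fibre (.inr pp)),
    haveI : Fact (pp : ℕ).Prime := ⟨pp.2⟩; placeOf X pp.1 x ∉ X.S → ‖tq pp x‖ = 1)

/-- **THE k2 IMPLICATION PER CELL: the real I06⋆ cell at the places over `p` gives the (xi-f) licence cell at `(j, p)`** (`j = i+1`). At
abc-iut-c312-3's `settingDHVolSharp`, over a prime `p > 2` whose fibre is uniformly TAME (`e(x|p) = e ≤ p − 2` at every `x | p`, norm
uniformizers `ϖ_x`), with HONEST integer exponents `‖t_{q,w}‖ = ‖ϖ_w‖^{m_q(w)}`, `‖t_{Θ,j,w}‖ = ‖ϖ_w‖^{j²·m_q(w)}`, `m_q(w) ≥ 1`: if at every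
`w | p` the q-idele lies in the `j²`-power log-shell orbit `t_{q,w} ∈ t_{q,w}^{j²} · ℐ_{K_w}` (rp-d2's REAL I06⋆ cell), then the q-pilot
region at `(j, p)` lies in the holomorphic hull `ⁿ˚𝒰_{j,p}`. Route: §1 ⟹ `(j²−1)·m_q ≤ e − 1 ≤ j·(e−1)` ⟹ abc-iut-w5-d009's
`tame_exact_of_sufficient_leg` ⟹ abc-iut-w5-d180's movers through p445158. [cite: DupuyHilado2025, §3.4, §3.9, §4.9]
[cite: Mochizuki2012, IUTchIV Prop. 1.2 (i)(ii) p. 10] [claim: Mochizuki2012, status: disputed] -/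
theorem qRegion_subset_thetaHull_settingDHVolSharp_of_realStar_tame (i : Fin (thetaIndex X).lstar) (pp : Nat.Primes)
    (hp2 : 2 < (pp : ℕ)) (e : ℕ) (hep : e ≤ (pp : ℕ) - 2)
    (ϖ : haveI : Fact (pp : ℕ).Prime := ⟨pp.2⟩; ∀ x : (thetaIndex X).Fibre (.inr pp), (kOf X pp.1 x)ˣ)
    (hfib : haveI : Fact (pp : ℕ).Prime := ⟨pp.2⟩
      ∀ x : (thetaIndex X).Fibre (.inr pp), (placeOf X pp.1 x).asIdeal.ramificationIdx ℤ = e ∧ IsUniformizer (ϖ x))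
    (mq : (thetaIndex X).Fibre (.inr pp) → ℤ)
    (hΘ : haveI : Fact (pp : ℕ).Prime := ⟨pp.2⟩
      ∀ w : (thetaIndex X).Fibre (.inr pp), ‖t pp i w‖ = ‖(ϖ w : kOf X pp.1 w)‖ ^ (((((i : ℕ) + 1) ^ 2 : ℕ) : ℤ) * mq w))
    (hq : haveI : Fact (pp : ℕ).Prime := ⟨pp.2⟩
      ∀ w : (thetaIndex X).Fibre (.inr pp), ‖tq pp w‖ = ‖(ϖ w : kOf X pp.1 w)‖ ^ mq w)
    (h1 : ∀ w, 1 ≤ mq w)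
    (hstar : haveI : Fact (pp : ℕ).Prime := ⟨pp.2⟩
      ∀ w : (thetaIndex X).Fibre (.inr pp),
        tq pp w ∈ tq pp w ^ (((i : ℕ) + 1) ^ 2) • logShell (PadicLogOnUnits.ofUnitLog (pp : ℕ) (kOf X pp.1 w))) :
    (settingDHVolSharp X hlog M archPk archSub Ψ act Mmod region n lat sig split qData tq t htq0 htq1).qRegion
        (labelSucc i) (.inr pp) ⊆
      (settingDHVolSharp X hlog M archPk archSub Ψ act Mmod region n lat sig split qData tq t htq0 htq1).thetaHull
        (labelSucc i) (.inr pp) := by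
  haveI hF : Fact (pp : ℕ).Prime := ⟨pp.2⟩
  refine (qRegion_subset_thetaHull_settingDHVolSharp_iff_of_tame_orders X hlog M archPk archSub Ψ act Mmod region n lat sig split
    qData tq t htq0 htq1 i pp hp2 e hep ϖ hfib (fun w => ((((i : ℕ) + 1) ^ 2 : ℕ) : ℤ) * mq w) mq hΘ hq ?_).2 ?_
  · -- `1 ≤ j²·m_q`
    intro w
    have hj : (1 : ℤ) ≤ ((((i : ℕ) + 1) ^ 2 : ℕ) : ℤ) := by exact_mod_cast Nat.one_le_pow _ _ (Nat.succ_pos i)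
    nlinarith [h1 w]
  · intro w
    have heK : absRamificationIdx (pp : ℕ) (kOf X pp.1 w) = e :=
      (absRamificationIdx_rescaledCompletion F (pp : ℕ) (placeOf X pp.1 w) (natCast_mem_placeOf X pp.1 w)).trans (hfib w).1
    have he1 : (1 : ℤ) ≤ e := by
      have := absRamificationIdx_pos (pp : ℕ) (kOf X pp.1 w)
      rw [heK] at this
      exact_mod_cast this
    have hew : absRamificationIdx (pp : ℕ) (kOf X pp.1 w) ≤ (pp : ℕ) - 2 := heK.le.trans hep
    -- the I06⋆ cell in integer currency: `(j² − 1)·m_q ≤ e − 1`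
    have hle := (mem_pow_smul_logShell_iff_int_of_tame_unif (pp : ℕ) (kOf X pp.1 w) hp2 hew (hfib w).2 (htq0 pp w) (hq w)
      (((i : ℕ) + 1) ^ 2)).1 (hstar w)
    rw [heK] at hle
    -- w5-d009's sufficient leg at `L = j`
    have hsuff : (((i : ℤ) + 1) ^ 2 - 1) * mq w ≤ ((i : ℤ) + 1) * ((e : ℤ) - 1) := by
      push_cast at hle
      have hm : 0 ≤ mq w := le_trans zero_le_one (h1 w)
      nlinarith [hle, he1, hm]
    have hex := tame_exact_of_sufficient_leg (e := (e : ℤ)) (j := (i : ℤ) + 1) (L := (i : ℤ) + 1) (P := mq w) he1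
      (le_trans zero_le_one (h1 w)) (by omega) le_rfl hsuff
    push_cast
    exact hex

/-- **THE LICENCE CELL FORCES THE LINEAR SHELL CELL** (same tame packet): if the q-pilot region at `(j, p)` lies in `ⁿ˚𝒰_{j,p}`, then at every
`w | p` the q-idele lies in the `j`-power (LINEAR exponent) log-shell orbit `t_{q,w} ∈ t_{q,w}^{j} · ℐ_{K_w}` — abc-iut-w5-d009's necessary leg
`(j−1)·m_q ≤ e−1` read back through §1. [cite: DupuyHilado2025, §3.4, §4.9] [cite: Mochizuki2012, IUTchIV Prop. 1.2 (i)(ii) p. 10]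
[claim: Mochizuki2012, status: disputed] -/
theorem realLinear_of_qRegion_subset_thetaHull_settingDHVolSharp_tame (i : Fin (thetaIndex X).lstar) (pp : Nat.Primes)
    (hp2 : 2 < (pp : ℕ)) (e : ℕ) (hep : e ≤ (pp : ℕ) - 2)
    (ϖ : haveI : Fact (pp : ℕ).Prime := ⟨pp.2⟩; ∀ x : (thetaIndex X).Fibre (.inr pp), (kOf X pp.1 x)ˣ)
    (hfib : haveI : Fact (pp : ℕ).Prime := ⟨pp.2⟩
      ∀ x : (thetaIndex X).Fibre (.inr pp), (placeOf X pp.1 x).asIdeal.ramificationIdx ℤ = e ∧ IsUniformizer (ϖ x))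
    (mq : (thetaIndex X).Fibre (.inr pp) → ℤ)
    (hΘ : haveI : Fact (pp : ℕ).Prime := ⟨pp.2⟩
      ∀ w : (thetaIndex X).Fibre (.inr pp), ‖t pp i w‖ = ‖(ϖ w : kOf X pp.1 w)‖ ^ (((((i : ℕ) + 1) ^ 2 : ℕ) : ℤ) * mq w))
    (hq : haveI : Fact (pp : ℕ).Prime := ⟨pp.2⟩
      ∀ w : (thetaIndex X).Fibre (.inr pp), ‖tq pp w‖ = ‖(ϖ w : kOf X pp.1 w)‖ ^ mq w)
    (h1 : ∀ w, 1 ≤ mq w)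
    (hincl : (settingDHVolSharp X hlog M archPk archSub Ψ act Mmod region n lat sig split qData tq t htq0 htq1).qRegion
        (labelSucc i) (.inr pp) ⊆
      (settingDHVolSharp X hlog M archPk archSub Ψ act Mmod region n lat sig split qData tq t htq0 htq1).thetaHull
        (labelSucc i) (.inr pp)) :
    haveI : Fact (pp : ℕ).Prime := ⟨pp.2⟩
    ∀ w : (thetaIndex X).Fibre (.inr pp),
      tq pp w ∈ tq pp w ^ ((i : ℕ) + 1) • logShell (PadicLogOnUnits.ofUnitLog (pp : ℕ) (kOf X pp.1 w)) := by
  haveI hF : Fact (pp : ℕ).Prime := ⟨pp.2⟩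
  intro w
  have hall := (qRegion_subset_thetaHull_settingDHVolSharp_iff_of_tame_orders X hlog M archPk archSub Ψ act Mmod region n lat sig split
    qData tq t htq0 htq1 i pp hp2 e hep ϖ hfib (fun w => ((((i : ℕ) + 1) ^ 2 : ℕ) : ℤ) * mq w) mq hΘ hq (fun w => by
      have hj : (1 : ℤ) ≤ ((((i : ℕ) + 1) ^ 2 : ℕ) : ℤ) := by exact_mod_cast Nat.one_le_pow _ _ (Nat.succ_pos i)
      nlinarith [h1 w])).1 hincl w
  have heK : absRamificationIdx (pp : ℕ) (kOf X pp.1 w) = e :=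
    (absRamificationIdx_rescaledCompletion F (pp : ℕ) (placeOf X pp.1 w) (natCast_mem_placeOf X pp.1 w)).trans (hfib w).1
  have he1 : (1 : ℤ) ≤ e := by
    have := absRamificationIdx_pos (pp : ℕ) (kOf X pp.1 w)
    rw [heK] at this
    exact_mod_cast this
  have hew : absRamificationIdx (pp : ℕ) (kOf X pp.1 w) ≤ (pp : ℕ) - 2 := heK.le.trans hep
  have hex : (e : ℤ) * ((((i : ℤ) + 1) ^ 2 * mq w - 1) / e) + 1 - ((i : ℤ) + 1) * ((e : ℤ) - 1) ≤ mq w := by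
    push_cast at hall
    exact hall
  have hnec := necessary_leg_of_tame_exact (e := (e : ℤ)) (L := (i : ℤ) + 1) (P := mq w) he1 (by omega) hex
  refine (mem_pow_smul_logShell_iff_int_of_tame_unif (pp : ℕ) (kOf X pp.1 w) hp2 hew (hfib w).2 (htq0 pp w) (hq w)
    ((i : ℕ) + 1)).2 ?_
  rw [heK]
  push_cast
  linarith

/-! ## §3. All bad fibres uniformly tame: the licence and branch C's S_H antecedent from the I06⋆ cells -/

/-- **THE (xi-f) LICENCE at `settingPrVolSharp` FROM THE REAL I06⋆ CELLS**, all bad fibres uniformly tame. Θ-ideles units off `S`; at every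
prime `p` under `S` a uniformly tame fibre (`p > 2`, `e(x|p) = e_p ≤ p − 2`, uniformizers); at every bad `w | p` honest integer exponents
`‖t_{q,w}‖ = ‖ϖ_w‖^{m_q(w)}`, `‖t_{Θ,j,w}‖ = ‖ϖ_w‖^{j²·m_q(w)}`, `m_q(w) ≥ 1`; and at every bad `w` and every label `j ∈ 𝔽_l^⋇` the REAL I06⋆ cell
`t_{q,w} ∈ t_{q,w}^{j²}·ℐ_{K_w}`. THEN abc-iut-c312-1's `Thm311ToCor312.Licence` holds at abc-iut-c312-7's `settingPrVolSharp`
(`licence_settingPrVolSharp_iff_of_tame_orders`, p445547, (←) leg fed by §1). [cite: DupuyHilado2025, §3.4, §3.9, §4.9]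
[cite: Mochizuki2012, IUTchIV Prop. 1.2 (i)(ii) p. 10] [claim: Mochizuki2012, status: disputed] -/
theorem licence_settingPrVolSharp_of_realStar_tame
    (ht1 : ∀ (pp : Nat.Primes) (i : Fin X.lstar) (x : (thetaIndex X).Fibre (.inr pp)),
      haveI : Fact (pp : ℕ).Prime := ⟨pp.2⟩; placeOf X pp.1 x ∉ X.S → ‖t pp i x‖ = 1)
    (e : Nat.Primes → ℕ)
    (ϖ : ∀ (pp : Nat.Primes) (x : (thetaIndex X).Fibre (.inr pp)), haveI : Fact (pp : ℕ).Prime := ⟨pp.2⟩; (kOf X pp.1 x)ˣ)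
    (hfib : ∀ (pp : Nat.Primes) (x : (thetaIndex X).Fibre (.inr pp)),
      haveI : Fact (pp : ℕ).Prime := ⟨pp.2⟩
      (∃ w : (thetaIndex X).Fibre (.inr pp), placeOf X pp.1 w ∈ X.S) →
        2 < (pp : ℕ) ∧ e pp ≤ (pp : ℕ) - 2 ∧ (placeOf X pp.1 x).asIdeal.ramificationIdx ℤ = e pp ∧ IsUniformizer (ϖ pp x))
    (mq : ∀ pp : Nat.Primes, (thetaIndex X).Fibre (.inr pp) → ℤ)
    (hΘ : ∀ (pp : Nat.Primes) (i : Fin (thetaIndex X).lstar) (w : (thetaIndex X).Fibre (.inr pp)),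
      haveI : Fact (pp : ℕ).Prime := ⟨pp.2⟩
      placeOf X pp.1 w ∈ X.S → ‖t pp i w‖ = ‖(ϖ pp w : kOf X pp.1 w)‖ ^ (((((i : ℕ) + 1) ^ 2 : ℕ) : ℤ) * mq pp w))
    (hq : ∀ (pp : Nat.Primes) (w : (thetaIndex X).Fibre (.inr pp)),
      haveI : Fact (pp : ℕ).Prime := ⟨pp.2⟩
      placeOf X pp.1 w ∈ X.S → ‖tq pp w‖ = ‖(ϖ pp w : kOf X pp.1 w)‖ ^ mq pp w)
    (h1 : ∀ (pp : Nat.Primes) (w : (thetaIndex X).Fibre (.inr pp)),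
      haveI : Fact (pp : ℕ).Prime := ⟨pp.2⟩; placeOf X pp.1 w ∈ X.S → 1 ≤ mq pp w)
    (hstar : ∀ (pp : Nat.Primes) (i : Fin (thetaIndex X).lstar) (w : (thetaIndex X).Fibre (.inr pp)),
      haveI : Fact (pp : ℕ).Prime := ⟨pp.2⟩
      placeOf X pp.1 w ∈ X.S →
        tq pp w ∈ tq pp w ^ (((i : ℕ) + 1) ^ 2) • logShell (PadicLogOnUnits.ofUnitLog (pp : ℕ) (kOf X pp.1 w))) :
    Thm311ToCor312.Licence (settingPrVolSharp X hlog M archPk archSub Ψ act Mmod region n lat sig split qData tq t htq0 htq1) := by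
  refine (licence_settingPrVolSharp_iff_of_tame_orders X hlog M archPk archSub Ψ act Mmod region n lat sig split qData tq t htq0 htq1
    ht1 e ϖ hfib (fun pp i w => ((((i : ℕ) + 1) ^ 2 : ℕ) : ℤ) * mq pp w) mq hΘ hq ?_).2 ?_
  · intro pp i w hw
    have hj : (1 : ℤ) ≤ ((((i : ℕ) + 1) ^ 2 : ℕ) : ℤ) := by exact_mod_cast Nat.one_le_pow _ _ (Nat.succ_pos i)
    nlinarith [h1 pp w hw]
  · intro pp i w hw
    haveI hF : Fact (pp : ℕ).Prime := ⟨pp.2⟩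
    obtain ⟨hp2, hep, hram, hunif⟩ := hfib pp w ⟨w, hw⟩
    have heK : absRamificationIdx (pp : ℕ) (kOf X pp.1 w) = e pp :=
      (absRamificationIdx_rescaledCompletion F (pp : ℕ) (placeOf X pp.1 w) (natCast_mem_placeOf X pp.1 w)).trans hram
    have he1 : (1 : ℤ) ≤ e pp := by
      have := absRamificationIdx_pos (pp : ℕ) (kOf X pp.1 w)
      rw [heK] at this
      exact_mod_cast this
    have hew : absRamificationIdx (pp : ℕ) (kOf X pp.1 w) ≤ (pp : ℕ) - 2 := heK.le.trans hep
    have hle := (mem_pow_smul_logShell_iff_int_of_tame_unif (pp : ℕ) (kOf X pp.1 w) hp2 hew hunif (htq0 pp w) (hq pp w hw)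
      (((i : ℕ) + 1) ^ 2)).1 (hstar pp i w hw)
    rw [heK] at hle
    have hm : 0 ≤ mq pp w := le_trans zero_le_one (h1 pp w hw)
    have hsuff : (((i : ℤ) + 1) ^ 2 - 1) * mq pp w ≤ ((i : ℤ) + 1) * ((e pp : ℤ) - 1) := by
      push_cast at hle
      nlinarith [hle, he1, hm]
    have hex := tame_exact_of_sufficient_leg (e := (e pp : ℤ)) (j := (i : ℤ) + 1) (L := (i : ℤ) + 1) (P := mq pp w) he1 hm
      (by omega) le_rfl hsuff
    push_cast
    exact hex

/-- **… hence BRANCH C's PER-DATUM S_H ANTECEDENT «∃ ρ qK, QPinned ∧ PilotKummerCompatHull»** at `settingPrVolSharp` (any columns `col`;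
q-ideles of norm `≤ 1`, abc-iut-w5-d009's `exists_qPinned_and_hull_settingPrVolSharp_iff_licence`). The k2 target shape of R-H (START-HERE §3
(k2)) reached from the I06⋆ cells at all-tame data. [cite: DupuyHilado2025, §3.4, §3.9, §4.9] [claim: Mochizuki2012, status: disputed] -/
theorem exists_qPinned_and_hull_settingPrVolSharp_of_realStar_tame (col : ℤ → Column (logShellsDH X logv))
    (htqle : ∀ pp x, ‖tq pp x‖ ≤ 1)
    (ht1 : ∀ (pp : Nat.Primes) (i : Fin X.lstar) (x : (thetaIndex X).Fibre (.inr pp)),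
      haveI : Fact (pp : ℕ).Prime := ⟨pp.2⟩; placeOf X pp.1 x ∉ X.S → ‖t pp i x‖ = 1)
    (e : Nat.Primes → ℕ)
    (ϖ : ∀ (pp : Nat.Primes) (x : (thetaIndex X).Fibre (.inr pp)), haveI : Fact (pp : ℕ).Prime := ⟨pp.2⟩; (kOf X pp.1 x)ˣ)
    (hfib : ∀ (pp : Nat.Primes) (x : (thetaIndex X).Fibre (.inr pp)),
      haveI : Fact (pp : ℕ).Prime := ⟨pp.2⟩
      (∃ w : (thetaIndex X).Fibre (.inr pp), placeOf X pp.1 w ∈ X.S) →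
        2 < (pp : ℕ) ∧ e pp ≤ (pp : ℕ) - 2 ∧ (placeOf X pp.1 x).asIdeal.ramificationIdx ℤ = e pp ∧ IsUniformizer (ϖ pp x))
    (mq : ∀ pp : Nat.Primes, (thetaIndex X).Fibre (.inr pp) → ℤ)
    (hΘ : ∀ (pp : Nat.Primes) (i : Fin (thetaIndex X).lstar) (w : (thetaIndex X).Fibre (.inr pp)),
      haveI : Fact (pp : ℕ).Prime := ⟨pp.2⟩
      placeOf X pp.1 w ∈ X.S → ‖t pp i w‖ = ‖(ϖ pp w : kOf X pp.1 w)‖ ^ (((((i : ℕ) + 1) ^ 2 : ℕ) : ℤ) * mq pp w))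
    (hq : ∀ (pp : Nat.Primes) (w : (thetaIndex X).Fibre (.inr pp)),
      haveI : Fact (pp : ℕ).Prime := ⟨pp.2⟩
      placeOf X pp.1 w ∈ X.S → ‖tq pp w‖ = ‖(ϖ pp w : kOf X pp.1 w)‖ ^ mq pp w)
    (h1 : ∀ (pp : Nat.Primes) (w : (thetaIndex X).Fibre (.inr pp)),
      haveI : Fact (pp : ℕ).Prime := ⟨pp.2⟩; placeOf X pp.1 w ∈ X.S → 1 ≤ mq pp w)
    (hstar : ∀ (pp : Nat.Primes) (i : Fin (thetaIndex X).lstar) (w : (thetaIndex X).Fibre (.inr pp)),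
      haveI : Fact (pp : ℕ).Prime := ⟨pp.2⟩
      placeOf X pp.1 w ∈ X.S →
        tq pp w ∈ tq pp w ^ (((i : ℕ) + 1) ^ 2) • logShell (PadicLogOnUnits.ofUnitLog (pp : ℕ) (kOf X pp.1 w))) :
    ∃ (ρ : (∀ v : (thetaIndex X).V, v ∈ (thetaIndex X).Vbad → Set ((logShellsDH X logv).StarPacket v)) →
          ∀ (j : (thetaIndex X).Label) (vQ : (thetaIndex X).VQ), Set ((logShellsDH X logv).Packet j vQ))
        (qK : ∀ v : (thetaIndex X).V, v ∈ (thetaIndex X).Vbad → Set ((logShellsDH X logv).StarPacket v)),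
        QPinned ({ toSituation := situationPrVol X hlog M archPk archSub Ψ act Mmod region, col := col } :
            LatticeSituation (thetaIndex X))
          (settingPrVolSharp X hlog M archPk archSub Ψ act Mmod region n lat sig split qData tq t htq0 htq1) ρ qK ∧
        PilotKummerCompatHull ({ toSituation := situationPrVol X hlog M archPk archSub Ψ act Mmod region, col := col } :
            LatticeSituation (thetaIndex X))
          (settingPrVolSharp X hlog M archPk archSub Ψ act Mmod region n lat sig split qData tq t htq0 htq1) ρ qK :=
  (exists_qPinned_and_hull_settingPrVolSharp_iff_licence X hlog M archPk archSub Ψ act Mmod region n lat sig split qData tq t htq0 htq1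
      col htqle).2
    (licence_settingPrVolSharp_of_realStar_tame X hlog M archPk archSub Ψ act Mmod region n lat sig split qData tq t htq0 htq1 ht1 e ϖ
      hfib mq hΘ hq h1 hstar)

/-- **THE LICENCE FORCES THE LINEAR SHELL CELLS at every bad tame place and every label** (necessity, licence level).
[cite: DupuyHilado2025, §3.4, §4.9] [claim: Mochizuki2012, status: disputed] -/
theorem realLinear_of_licence_settingPrVolSharp_tame
    (ht1 : ∀ (pp : Nat.Primes) (i : Fin X.lstar) (x : (thetaIndex X).Fibre (.inr pp)),
      haveI : Fact (pp : ℕ).Prime := ⟨pp.2⟩; placeOf X pp.1 x ∉ X.S → ‖t pp i x‖ = 1)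
    (e : Nat.Primes → ℕ)
    (ϖ : ∀ (pp : Nat.Primes) (x : (thetaIndex X).Fibre (.inr pp)), haveI : Fact (pp : ℕ).Prime := ⟨pp.2⟩; (kOf X pp.1 x)ˣ)
    (hfib : ∀ (pp : Nat.Primes) (x : (thetaIndex X).Fibre (.inr pp)),
      haveI : Fact (pp : ℕ).Prime := ⟨pp.2⟩
      (∃ w : (thetaIndex X).Fibre (.inr pp), placeOf X pp.1 w ∈ X.S) →
        2 < (pp : ℕ) ∧ e pp ≤ (pp : ℕ) - 2 ∧ (placeOf X pp.1 x).asIdeal.ramificationIdx ℤ = e pp ∧ IsUniformizer (ϖ pp x))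
    (mq : ∀ pp : Nat.Primes, (thetaIndex X).Fibre (.inr pp) → ℤ)
    (hΘ : ∀ (pp : Nat.Primes) (i : Fin (thetaIndex X).lstar) (w : (thetaIndex X).Fibre (.inr pp)),
      haveI : Fact (pp : ℕ).Prime := ⟨pp.2⟩
      placeOf X pp.1 w ∈ X.S → ‖t pp i w‖ = ‖(ϖ pp w : kOf X pp.1 w)‖ ^ (((((i : ℕ) + 1) ^ 2 : ℕ) : ℤ) * mq pp w))
    (hq : ∀ (pp : Nat.Primes) (w : (thetaIndex X).Fibre (.inr pp)),
      haveI : Fact (pp : ℕ).Prime := ⟨pp.2⟩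
      placeOf X pp.1 w ∈ X.S → ‖tq pp w‖ = ‖(ϖ pp w : kOf X pp.1 w)‖ ^ mq pp w)
    (h1 : ∀ (pp : Nat.Primes) (w : (thetaIndex X).Fibre (.inr pp)),
      haveI : Fact (pp : ℕ).Prime := ⟨pp.2⟩; placeOf X pp.1 w ∈ X.S → 1 ≤ mq pp w)
    (hL : Thm311ToCor312.Licence (settingPrVolSharp X hlog M archPk archSub Ψ act Mmod region n lat sig split qData tq t htq0 htq1)) :
    ∀ (pp : Nat.Primes) (i : Fin (thetaIndex X).lstar) (w : (thetaIndex X).Fibre (.inr pp)),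
      haveI : Fact (pp : ℕ).Prime := ⟨pp.2⟩
      placeOf X pp.1 w ∈ X.S →
        tq pp w ∈ tq pp w ^ ((i : ℕ) + 1) • logShell (PadicLogOnUnits.ofUnitLog (pp : ℕ) (kOf X pp.1 w)) := by
  intro pp i w hw
  haveI hF : Fact (pp : ℕ).Prime := ⟨pp.2⟩
  have hall := (licence_settingPrVolSharp_iff_of_tame_orders X hlog M archPk archSub Ψ act Mmod region n lat sig split qData tq t htq0
    htq1 ht1 e ϖ hfib (fun pp i w => ((((i : ℕ) + 1) ^ 2 : ℕ) : ℤ) * mq pp w) mq hΘ hq (fun pp i w hw => by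
      have hj : (1 : ℤ) ≤ ((((i : ℕ) + 1) ^ 2 : ℕ) : ℤ) := by exact_mod_cast Nat.one_le_pow _ _ (Nat.succ_pos i)
      nlinarith [h1 pp w hw])).1 hL pp i w hw
  obtain ⟨hp2, hep, hram, hunif⟩ := hfib pp w ⟨w, hw⟩
  have heK : absRamificationIdx (pp : ℕ) (kOf X pp.1 w) = e pp :=
    (absRamificationIdx_rescaledCompletion F (pp : ℕ) (placeOf X pp.1 w) (natCast_mem_placeOf X pp.1 w)).trans hram
  have he1 : (1 : ℤ) ≤ e pp := by
    have := absRamificationIdx_pos (pp : ℕ) (kOf X pp.1 w)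
    rw [heK] at this
    exact_mod_cast this
  have hew : absRamificationIdx (pp : ℕ) (kOf X pp.1 w) ≤ (pp : ℕ) - 2 := heK.le.trans hep
  have hex : (e pp : ℤ) * ((((i : ℤ) + 1) ^ 2 * mq pp w - 1) / e pp) + 1 - ((i : ℤ) + 1) * ((e pp : ℤ) - 1) ≤ mq pp w := by
    push_cast at hall
    exact hall
  have hnec := necessary_leg_of_tame_exact (e := (e pp : ℤ)) (L := (i : ℤ) + 1) (P := mq pp w) he1 (by omega) hex
  refine (mem_pow_smul_logShell_iff_int_of_tame_unif (pp : ℕ) (kOf X pp.1 w) hp2 hew hunif (htq0 pp w) (hq pp w hw)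
    ((i : ℕ) + 1)).2 ?_
  rw [heK]
  push_cast
  linarith

/-- **(B) THE LICENCE CELL EXACTLY, IN I06⋆ CURRENCY** (v2; START-HERE v1.1 §3 (L1)): at the tame packet of (A), q-region at `(j, p)` ⊆ `ⁿ˚𝒰_{j,p}`
**iff** `∀ w | p, (j²−1)·m_q(w) − j·(e−1) ≤ (j²·m_q(w) − 1) mod e` (p445158 through abc-iut-w5-d009's `tame_exact_iff_emod`); next to §1's I06⋆
cell `(j²−1)·m_q(w) ≤ e−1` this is the band `θ_j ∈ [1, j]`. [cite: DupuyHilado2025, §3.4, §4.9] [claim: Mochizuki2012, status: disputed] -/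
theorem qRegion_subset_thetaHull_settingDHVolSharp_iff_emod_tame (i : Fin (thetaIndex X).lstar) (pp : Nat.Primes) (hp2 : 2 < (pp : ℕ))
    (e : ℕ) (hep : e ≤ (pp : ℕ) - 2) (ϖ : haveI : Fact (pp : ℕ).Prime := ⟨pp.2⟩; ∀ x : (thetaIndex X).Fibre (.inr pp), (kOf X pp.1 x)ˣ)
    (hfib : haveI : Fact (pp : ℕ).Prime := ⟨pp.2⟩; ∀ x, (placeOf X pp.1 x).asIdeal.ramificationIdx ℤ = e ∧ IsUniformizer (ϖ x))
    (mq : (thetaIndex X).Fibre (.inr pp) → ℤ)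
    (hΘ : haveI : Fact (pp : ℕ).Prime := ⟨pp.2⟩; ∀ w, ‖t pp i w‖ = ‖(ϖ w : kOf X pp.1 w)‖ ^ (((((i : ℕ) + 1) ^ 2 : ℕ) : ℤ) * mq w))
    (hq : haveI : Fact (pp : ℕ).Prime := ⟨pp.2⟩; ∀ w, ‖tq pp w‖ = ‖(ϖ w : kOf X pp.1 w)‖ ^ mq w) (h1 : ∀ w, 1 ≤ mq w) :
    (settingDHVolSharp X hlog M archPk archSub Ψ act Mmod region n lat sig split qData tq t htq0 htq1).qRegion (labelSucc i) (.inr pp) ⊆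
        (settingDHVolSharp X hlog M archPk archSub Ψ act Mmod region n lat sig split qData tq t htq0 htq1).thetaHull (labelSucc i) (.inr pp) ↔
      ∀ w : (thetaIndex X).Fibre (.inr pp),
        (((i : ℤ) + 1) ^ 2 - 1) * mq w - ((i : ℤ) + 1) * ((e : ℤ) - 1) ≤ (((i : ℤ) + 1) ^ 2 * mq w - 1) % (e : ℤ) := by
  haveI hF : Fact (pp : ℕ).Prime := ⟨pp.2⟩
  rw [qRegion_subset_thetaHull_settingDHVolSharp_iff_of_tame_orders X hlog M archPk archSub Ψ act Mmod region n lat sig split qData tq t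
    htq0 htq1 i pp hp2 e hep ϖ hfib (fun w => ((((i : ℕ) + 1) ^ 2 : ℕ) : ℤ) * mq w) mq hΘ hq (fun w => by
      have hj : (1 : ℤ) ≤ ((((i : ℕ) + 1) ^ 2 : ℕ) : ℤ) := by exact_mod_cast Nat.one_le_pow _ _ (Nat.succ_pos i)
      nlinarith [h1 w])]
  refine forall_congr' fun w => ?_
  have h0 := absRamificationIdx_pos (pp : ℕ) (kOf X pp.1 w)
  rw [(absRamificationIdx_rescaledCompletion F (pp : ℕ) (placeOf X pp.1 w) (natCast_mem_placeOf X pp.1 w)).trans (hfib w).1] at h0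
  push_cast
  exact tame_exact_iff_emod (by exact_mod_cast h0) ((i : ℤ) + 1) (mq w)

end Setting

end Summit.ABC.IUTFork.Repair.CandInternal2RealLabelsLicence

end
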